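import Summits.QuantumFields.YangMills.Theses.BalabanUVNodes
import Summits.QuantumFields.YangMills.Theorems.BalabanUVNodesN27AtAllPinsOfRecord13CoPHVCutBFreeKing

/-!
# ★ K3⁸ LEAF MLCⱽ: `SpineGivenEndpointR13SepCoPHV` BY NAME FROM THE MINTED ALL-PINS READING — leaf LEAF-C `…SepCoPHVAllPinsOfRecordVBFreeKing` (dag-n27-c g15; (B)-free spine body road, King-mechanism currency, WINDOWED kernels (the ℤ⁴ edition is the sibling `…VMintedReadingVBFreeKingZ4`); spine pinned at live, free off the live line)
# WITH ITS FOUR v5∕v6 READING PINS DISCHARGED (`rfl`), every N19′ face at the SPELLED BUNDLE OF LETTERS, no rate reading `𝔯` in any statement (cell `pub-ymgap`, D-0062 Track A;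
# WIDTH SEAT `pub-ymgap-dag-n27-w1` gen 4; dag-n27-c g15 «minted twins of the `…SepCoPHV…` leaves = YOURS — GO» l.35881; K3⁸ = stmt-QuantumFields-27366, `--supports 27366 --as helper`;
# COUNT-NEUTRAL; theorems ⊢ THE ITEM `Theses.BalabanUVNodes.SpineGivenEndpointR13SepCoPHV`, 0 `def`, 0 `sorry`; route-facing leaf, nothing may import it; imports = the parent's own,
# the parent NOT imported; `N = 2`)

WHY.  gen 3 (p608315 ∕ p609478) and gen 4 (`K3V6StubsLetterForm` p629121): the stub TEXTS — v5's and the REGISTERED v6's — ⟺ READING-FREE LETTER FORMS; the all-pins reading is MINTED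
for every letter choice (`𝔯 := ⟨fun F θ hP g₀ os ↦ ⟨objectsOfRecord₁₃ F N θ (ℓ F θ), fun _ ↦ loose N16 layer (ℓ₃, B), fun _ ↦ fullGSizedObjects 3 F.hL b a_S …⟩, ne1OfRecord l₀ Λ⟩`, four `rfl`) and
its bundle IS the spelled bundle of letters, so every all-pins storey ∕ leaf has a twin with NO rate reading in its statement: the parent's binders with the four pin lines REPLACED by
`(hl₀ : 0 < l₀) (hΛ : 0 ≤ Λ) (hb : 0 < b) (haS : 0 < aS)` and every N19′ bundle SPELLED; proofs = the parent's bodies VERBATIM behind the minting prelude (generator `gen_minted.py`, regression-identical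
on g3's APK ↦ MPK ∕ AKL ↦ MKL).
★★★ `spineGivenEndpointR13SepCoPHV_of_liveMintedV5PinsAtCrOfRecord₁₃VAt_cut_offLive_mintedV5Pins_bFree_of_kingMechanism` — the slot's (B) ∕ END antecedents DISCARDED exactly as in the parent (`fun F θ h v hG hθ _ _ ↦ …`, DEF-1's `rfl` faces).

HONEST FRAMING.  COMPOSITE-node bookkeeping BY NAME; NOT a discharge: terms of the item's type under displayed hypotheses (audit `proof.conditional`); every displayed antecedent is a HYPOTHESIS inhabited for no family today (K0⁷ `Record13SepCoPHInhabited` OPEN) or a decided MODEL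
inside the minted reading (n14-w1's datum-read tower, dag-n15-a's sized genuine family — MODEL LEVEL, v5∕v6's own labels); the kernel letters ∕ level-0 rows ∕ King's three-factor rows are
Bałaban-type SHAPES (King's U(1) mechanism [King1986] transposed) NOT PRINTED as such for d = 4, proved nowhere; THE END's N16 sentence a hypothesis; NE7-cluster ∕ K5 ∕ the N19′ edge ∕ node
U5's Target 0∕1 today; nothing of Bałaban's or King's asserted or instantiated; NOT `stub_rates13HV` ∕ `stub_expansion13HV`; N14–N22 ∕ N27 NOT discharged; K3⁸ stmt-QuantumFields-27366 OPEN,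
NOT claimed; skeleton v6 and every landed decl UNTOUCHED; K3⁷ 20544 aside; counts UNMOVED (typed 28∕28 · discharged 5∕27, A 5∕28); one finite four-torus programme at fixed `ε` — R4 closes
the CONDITIONAL finite-𝕋⁴ rung `BalabanLadder.UV` only: NOT ℝ⁴, NOT infinite volume, NOT OS, NOT a mass gap, NOT Clay.  No decl below carries a cite tag.
-/

set_option autoImplicit false

namespace Summit.QuantumFields.YangMills.Theorems.BalabanUVNodesN27SpineRecord

open scoped BigOperators Matrix.Norms.L2Operator
open Literature.MathematicalPhysics.QuantumFieldTheory.Balaban1983to89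
open Literature.MathematicalPhysics.QuantumFieldTheory.Balaban1983to89.T4Continuum
open Literature.MathematicalPhysics.QuantumFieldTheory.Balaban1983to89.Node00
open Literature.MathematicalPhysics.QuantumFieldTheory.Balaban1983to89.B12Sec2to5 (betaPrime510 l1)
open Literature.MathematicalPhysics.QuantumFieldTheory.Balaban1983to89.FlowStep (Box)
open Literature.MathematicalPhysics.QuantumFieldTheory.Balaban1983to89.Node00.U3OfKernels (objectsOfRecord₁₃ KernelDecayOfRecord₁₃)
open Literature.MathematicalPhysics.QuantumFieldTheory.Balaban1983to89.Node00.U3KernelLetters (GeometricIncrementsOfRecord₁₃ WindowedNE9OfRecord₁₃ WindowedDecayOfRecord₁₃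
  WindowedStepRateOfRecord₁₃)
open T4WeightBudget (RelWeightBound)
open T4IndicatorShell (ShellWeightBound)
open T4ContinuumYM4Torus (ForSmallCouplings)
open T4ApexHybrid (StringwiseHybridNE7)
open Summit.QuantumFields.BalabanUV.T4Continuum.Spine
open Summit.QuantumFields.BalabanUV.T4Continuum.MinimalActionRate (sfClass)
open Summit.QuantumFields.YangMills.Theses.BalabanUVNodes (SpineGivenEndpointR13SepCoPHV)
open YMDAG.UVSplit
open Summit.QuantumFields.YangMills.BalabanUVNodes.N19TargetClassWeightsE1Keyed
open Summit.QuantumFields.YangMills.BalabanUVNodes.N16HolderDefs (N16HolderAt)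
open Summit.QuantumFields.YangMills.BalabanUVNodes.SpineRatesHolder (RatesHolderAt)
open YMDAG.N14.TopBorn (ne1OfRecord Ne1PinnedOfRecord n14At_rateCarriersOfRecord₁₃CoPH_of_pinned)
open Summit.QuantumFields.YangMills.BalabanUVNodes.N15.GenuineRecord (fullGSizedObjects n15At_fullGSizedObjects_family)
open Summit.QuantumFields.YangMills.BalabanUVNodes.N15.AtKeyedHome (neZero_blockFactor)
open Summit.QuantumFields.YangMills.BalabanUVNodes.N16PinnedLayer13CoPH (N16PinnedLoose rateCarriers_ne3_of_pinnedLoose)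
open YMDAG.N18.PolLimitRate (u3KernelInputs_of_finiteVolumeLetters)
open Matrix Filter
open Literature.MathematicalPhysics.QuantumFieldTheory.Balaban1983to89.B12Decay510Window (K₁)
open Literature.MathematicalPhysics.QuantumFieldTheory.Balaban1983to89.T4OutputRate (Window)
open Literature.MathematicalPhysics.QuantumFieldTheory.Balaban1983to89.Node00.U3OfKernels (objectsOfRecord₁₃ KernelDecayOfRecord₁₃ pt bg)
open YMDAG.N18.PolLimitRate (n22At_u3OfRecord₁₃_objectsOfRecord₁₃_of_geometricIncrements_of_windowedNE9)

variable (K₀ : ℕ) (jc : (F : T4Family) → (θ : Stage13HParams F 2) → θ.Provisos₁₃CoPH F 2 → (ℕ → ℝ) → List (ULoop F) → ℕ → ℕ)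
  (sh : ShellSplit₁₃CoPH 2 K₀)
  (cr cr' : (F : T4Family) → (θ : Stage13HParams F 2) → θ.Provisos₁₃CoPH F 2 → (ℕ → ℝ) → List (ULoop F) → SpineCarriers)
  (β : ℝ)
  -- the LETTERS of the minted reading (N14 tower `l₀ Λ`; the sized genuine N15 family `b a_S ν μ α β′ c₃₅ p`; N16's letters `ℓ₃`, radius letter `B`; U3 block `ℓ` below)
  (l₀ Λ b aS : ℝ) (ν μ α β' : Fin 4) (c35 p : ℝ)
  (ksel : (F : T4Family) → (θ : Stage13HParams F 2) → θ.Provisos₁₃CoPH F 2 → (ℕ → ℝ) → List (ULoop F) → ℕ)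
  (ℓ : (F : T4Family) → Stage13HParams F 2 → U3Letters₁₁) (s : (F : T4Family) → Stage13HParams F 2 → ℕ) (r : (F : T4Family) → Stage13HParams F 2 → ℝ)
  (ℓ₃ : T4Family → NE3Letters₁₁) (B : T4Family → ℝ)

/-! ## §1 WINDOWED-KERNEL King currency — with the reading MINTED -/

section King

variable {PK : (F : T4Family) → Stage13HParams F 2 → ℕ → ℕ → Type*} {βK : (F : T4Family) → Stage13HParams F 2 → ℕ → ℕ → Type*}
  [∀ F θ K k, Fintype (βK F θ K k)]
  (ρd : (F : T4Family) → (θ : Stage13HParams F 2) → (K k : ℕ) → PK F θ K k → PK F θ K k → ℝ)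
  (q : (F : T4Family) → (θ : Stage13HParams F 2) → (K k : ℕ) → βK F θ K k → PK F θ K k)
  (p₁ p₂ : (F : T4Family) → (θ : Stage13HParams F 2) → (K k : ℕ) → Fin 4 → Fin 4 → (Fin 4 → ℤ) → PK F θ K k)
  (uA vA : (F : T4Family) → (θ : Stage13HParams F 2) → (K k : ℕ) → (Fin (k + 1) → ℝ) → Fin 4 → Fin 4 → (Fin 4 → ℤ) → βK F θ K k → ℝ)
  (CA : (F : T4Family) → (θ : Stage13HParams F 2) → (K k : ℕ) → (Fin (k + 1) → ℝ) → Fin 4 → Fin 4 → (Fin 4 → ℤ) → Matrix (βK F θ K k) (βK F θ K k) ℝ)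
  (uB vB : (F : T4Family) → (θ : Stage13HParams F 2) → (K k : ℕ) → (Fin (k + 2) → ℝ) → Fin 4 → Fin 4 → (Fin 4 → ℤ) → βK F θ K k → ℝ)
  (CB : (F : T4Family) → (θ : Stage13HParams F 2) → (K k : ℕ) → (Fin (k + 2) → ℝ) → Fin 4 → Fin 4 → (Fin 4 → ℤ) → Matrix (βK F θ K k) (βK F θ K k) ℝ)
  (κK θK VK sA sC sB cA cC cB : (F : T4Family) → Stage13HParams F 2 → ℝ)

/-- ★★★ **THE ITEM AT EVERY VERSION SLOT FROM THE MINTED ALL-PINS READING — KING's THREE-FACTOR MECHANISM, WINDOWED KERNELS** — the parent's theorem with the four pin lines ↦ `(hl₀ : 0 < l₀) (hΛ : 0 ≤ Λ) (hb : 0 < b) (haS : 0 < aS)`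
and every N19′ bundle SPELLED; body VERBATIM behind the minting prelude.  No rate reading in the statement.  NOT a discharge; every row a HYPOTHESIS or a decided MODEL (K0⁷ OPEN); no stub closed. [bookkeeping] -/
theorem spineGivenEndpointR13SepCoPHV_of_liveMintedV5PinsAtCrOfRecord₁₃VAt_cut_offLive_mintedV5Pins_bFree_of_kingMechanism
    (hl₀ : 0 < l₀) (hΛ : 0 ≤ Λ) (hb : 0 < b) (haS : 0 < aS)
    (h16 : ∀ (F : T4Family), (∃ θ : Stage13HParams F 2, θ.Provisos₁₃CoPH F 2 ∧ (θ.ZhUnity F 2 ∧ θ.SlotsNondegenerate₁₃ F 2) ∧ θ.Admissible F 2) →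
      N16HolderAt (ne3OfRecord₁₁ F { ne3ConstLayerOfRecord₁₁ F 2 (ℓ₃ F) with
        dom := {V | V ∈ ne3DomOfRecord₁₁ F 2 0 0 ∧ V ∈ sfClass 4 F.L (ne3NperOfRecord₁₁ F 0 0) ((ℓ₃ F).ε / B F) 0} }) β)
    (hs : ∀ (F : T4Family) (θ : Stage13HParams F 2), θ.Provisos₁₃CoPH F 2 → (θ.ZhUnity F 2 ∧ θ.SlotsNondegenerate₁₃ F 2) → θ.Admissible F 2 → (ℓ F θ).Signs)
    (hκ : ∀ (F : T4Family) (θ : Stage13HParams F 2), θ.Provisos₁₃CoPH F 2 → (θ.ZhUnity F 2 ∧ θ.SlotsNondegenerate₁₃ F 2) → θ.Admissible F 2 → 0 < (ℓ F θ).κ)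
    (hcr : ∀ (F : T4Family) (θ : Stage13HParams F 2), θ.Provisos₁₃CoPH F 2 → (θ.ZhUnity F 2 ∧ θ.SlotsNondegenerate₁₃ F 2) → θ.Admissible F 2 →
      betaPrime510 4 1 (ℓ F θ).κ ≤ (ℓ F θ).cr)
    (hρ : ∀ (F : T4Family) (θ : Stage13HParams F 2), θ.Provisos₁₃CoPH F 2 → (θ.ZhUnity F 2 ∧ θ.SlotsNondegenerate₁₃ F 2) → θ.Admissible F 2 →
      0 ≤ (ℓ F θ).ρ ∧ (ℓ F θ).ρ < 1)
    (hr : ∀ (F : T4Family) (θ : Stage13HParams F 2), θ.Provisos₁₃CoPH F 2 → (θ.ZhUnity F 2 ∧ θ.SlotsNondegenerate₁₃ F 2) → θ.Admissible F 2 → r F θ < 1)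
    (hinc : ∀ (F : T4Family) (θ : Stage13HParams F 2), θ.Provisos₁₃CoPH F 2 → (θ.ZhUnity F 2 ∧ θ.SlotsNondegenerate₁₃ F 2) → θ.Admissible F 2 →
      GeometricIncrementsOfRecord₁₃ F 2 θ.toStage13Params (r F θ))
    (h9 : ∀ (F : T4Family) (θ : Stage13HParams F 2), θ.Provisos₁₃CoPH F 2 → (θ.ZhUnity F 2 ∧ θ.SlotsNondegenerate₁₃ F 2) → θ.Admissible F 2 →
      WindowedNE9OfRecord₁₃ F 2 θ.toStage13Params (ℓ F θ).κ (ℓ F θ).moduli)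
    (hks : ∀ (F : T4Family) (θ : Stage13HParams F 2), θ.Provisos₁₃CoPH F 2 → (θ.ZhUnity F 2 ∧ θ.SlotsNondegenerate₁₃ F 2) → θ.Admissible F 2 →
      0 ≤ κK F θ ∧ 0 ≤ θK F θ ∧ 0 ≤ sA F θ ∧ 0 ≤ sC F θ ∧ 0 ≤ sB F θ ∧ 0 ≤ cA F θ ∧ 0 ≤ cC F θ ∧ 0 ≤ cB F θ)
    (hρ0 : ∀ (F : T4Family) (θ : Stage13HParams F 2) (K k : ℕ) (t t' : PK F θ K k), 0 ≤ ρd F θ K k t t')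
    (hρtri : ∀ (F : T4Family) (θ : Stage13HParams F 2) (K k : ℕ) (t t' t'' : PK F θ K k), ρd F θ K k t t'' ≤ ρd F θ K k t t' + ρd F θ K k t' t'')
    (hd : ∀ (F : T4Family) (θ : Stage13HParams F 2) (K k : ℕ) (μ ν : Fin 4) (x : Fin 4 → ℤ), l1 x ≤ ρd F θ K k (p₁ F θ K k μ ν x) (p₂ F θ K k μ ν x))
    (hV : ∀ (F : T4Family) (θ : Stage13HParams F 2), θ.Provisos₁₃CoPH F 2 → (θ.ZhUnity F 2 ∧ θ.SlotsNondegenerate₁₃ F 2) → θ.Admissible F 2 →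
      ∀ (K k : ℕ) (t : PK F θ K k), ∑ i, Real.exp (-(κK F θ / 2 * ρd F θ K k t (q F θ K k i))) ≤ VK F θ)
    (hA : ∀ (F : T4Family) (θ : Stage13HParams F 2), θ.Provisos₁₃CoPH F 2 → (θ.ZhUnity F 2 ∧ θ.SlotsNondegenerate₁₃ F 2) → θ.Admissible F 2 →
      (letI := θ.instVβ₁; letI := θ.instVβ₂; letI := θ.instιβ
      ∀ (k : ℕ) (v : Fin (k + 1) → ℝ), v ∈ Box θ.γ k → ∀ (μ ν : Fin 4) (x : Fin 4 → ℤ), ∀ᶠ K in atTop,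
        polWindow F K (k + 1) (mergedTermFamilyMatT F 2 (TβOfRecord₁₃ F 2) (chiβOfRecord₁₃ F 2 θ.toStage13Params) θ.εbg k v K) θ.ρ8 θ.bV μ ν x =
          uA F θ K k v μ ν x ⬝ᵥ (CA F θ K k v μ ν x *ᵥ vA F θ K k v μ ν x)))
    (hB : ∀ (F : T4Family) (θ : Stage13HParams F 2), θ.Provisos₁₃CoPH F 2 → (θ.ZhUnity F 2 ∧ θ.SlotsNondegenerate₁₃ F 2) → θ.Admissible F 2 →
      (letI := θ.instVβ₁; letI := θ.instVβ₂; letI := θ.instιβ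
      ∀ (k : ℕ) (w : Fin (k + 2) → ℝ), w ∈ Box θ.γ (k + 1) → ∀ (μ ν : Fin 4) (x : Fin 4 → ℤ), ∀ᶠ K in atTop,
        polWindow F (K + s F θ) (k + 1 + 1) (mergedTermFamilyMatT F 2 (TβOfRecord₁₃ F 2) (chiβOfRecord₁₃ F 2 θ.toStage13Params) θ.εbg (k + 1) w (K + s F θ)) θ.ρ8 θ.bV μ ν x =
          uB F θ K k w μ ν x ⬝ᵥ (CB F θ K k w μ ν x *ᵥ vB F θ K k w μ ν x)))
    (hu : ∀ (F : T4Family) (θ : Stage13HParams F 2), θ.Provisos₁₃CoPH F 2 → (θ.ZhUnity F 2 ∧ θ.SlotsNondegenerate₁₃ F 2) → θ.Admissible F 2 →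
      ∀ (K k : ℕ) (v : Fin (k + 1) → ℝ) (μ ν : Fin 4) (x : Fin 4 → ℤ) (i : βK F θ K k),
        |uA F θ K k v μ ν x i| ≤ sA F θ * Real.exp (-(κK F θ * ρd F θ K k (p₁ F θ K k μ ν x) (q F θ K k i))))
    (hCA : ∀ (F : T4Family) (θ : Stage13HParams F 2), θ.Provisos₁₃CoPH F 2 → (θ.ZhUnity F 2 ∧ θ.SlotsNondegenerate₁₃ F 2) → θ.Admissible F 2 →
      ∀ (K k : ℕ) (v : Fin (k + 1) → ℝ) (μ ν : Fin 4) (x : Fin 4 → ℤ) (i i' : βK F θ K k),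
        |CA F θ K k v μ ν x i i'| ≤ sC F θ * Real.exp (-(κK F θ * ρd F θ K k (q F θ K k i) (q F θ K k i'))))
    (hvA : ∀ (F : T4Family) (θ : Stage13HParams F 2), θ.Provisos₁₃CoPH F 2 → (θ.ZhUnity F 2 ∧ θ.SlotsNondegenerate₁₃ F 2) → θ.Admissible F 2 →
      ∀ (K k : ℕ) (v : Fin (k + 1) → ℝ) (μ ν : Fin 4) (x : Fin 4 → ℤ) (i' : βK F θ K k),
        |vA F θ K k v μ ν x i'| ≤ sB F θ * Real.exp (-(κK F θ * ρd F θ K k (q F θ K k i') (p₂ F θ K k μ ν x))))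
    (hCB : ∀ (F : T4Family) (θ : Stage13HParams F 2), θ.Provisos₁₃CoPH F 2 → (θ.ZhUnity F 2 ∧ θ.SlotsNondegenerate₁₃ F 2) → θ.Admissible F 2 →
      ∀ (K k : ℕ) (w : Fin (k + 2) → ℝ) (μ ν : Fin 4) (x : Fin 4 → ℤ) (i i' : βK F θ K k),
        |CB F θ K k w μ ν x i i'| ≤ sC F θ * Real.exp (-(κK F θ * ρd F θ K k (q F θ K k i) (q F θ K k i'))))
    (hvB : ∀ (F : T4Family) (θ : Stage13HParams F 2), θ.Provisos₁₃CoPH F 2 → (θ.ZhUnity F 2 ∧ θ.SlotsNondegenerate₁₃ F 2) → θ.Admissible F 2 →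
      ∀ (K k : ℕ) (w : Fin (k + 2) → ℝ) (μ ν : Fin 4) (x : Fin 4 → ℤ) (i' : βK F θ K k),
        |vB F θ K k w μ ν x i'| ≤ sB F θ * Real.exp (-(κK F θ * ρd F θ K k (q F θ K k i') (p₂ F θ K k μ ν x))))
    (hdu : ∀ (F : T4Family) (θ : Stage13HParams F 2), θ.Provisos₁₃CoPH F 2 → (θ.ZhUnity F 2 ∧ θ.SlotsNondegenerate₁₃ F 2) → θ.Admissible F 2 →
      ∀ (K k : ℕ) (w : Fin (k + 2) → ℝ) (μ ν : Fin 4) (x : Fin 4 → ℤ) (i : βK F θ K k),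
        |uB F θ K k w μ ν x i - uA F θ K k (Fin.tail w) μ ν x i| ≤
          cA F θ * θK F θ ^ (k + 1) * Real.exp (-(κK F θ * ρd F θ K k (p₁ F θ K k μ ν x) (q F θ K k i))))
    (hdC : ∀ (F : T4Family) (θ : Stage13HParams F 2), θ.Provisos₁₃CoPH F 2 → (θ.ZhUnity F 2 ∧ θ.SlotsNondegenerate₁₃ F 2) → θ.Admissible F 2 →
      ∀ (K k : ℕ) (w : Fin (k + 2) → ℝ) (μ ν : Fin 4) (x : Fin 4 → ℤ) (i i' : βK F θ K k),
        |CB F θ K k w μ ν x i i' - CA F θ K k (Fin.tail w) μ ν x i i'| ≤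
          cC F θ * θK F θ ^ (k + 1) * Real.exp (-(κK F θ * ρd F θ K k (q F θ K k i) (q F θ K k i'))))
    (hdv : ∀ (F : T4Family) (θ : Stage13HParams F 2), θ.Provisos₁₃CoPH F 2 → (θ.ZhUnity F 2 ∧ θ.SlotsNondegenerate₁₃ F 2) → θ.Admissible F 2 →
      ∀ (K k : ℕ) (w : Fin (k + 2) → ℝ) (μ ν : Fin 4) (x : Fin 4 → ℤ) (i' : βK F θ K k),
        |vB F θ K k w μ ν x i' - vA F θ K k (Fin.tail w) μ ν x i'| ≤
          cB F θ * θK F θ ^ (k + 1) * Real.exp (-(κK F θ * ρd F θ K k (q F θ K k i') (p₂ F θ K k μ ν x))))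
    (hdom : ∀ (F : T4Family) (θ : Stage13HParams F 2), θ.Provisos₁₃CoPH F 2 → (θ.ZhUnity F 2 ∧ θ.SlotsNondegenerate₁₃ F 2) → θ.Admissible F 2 →
      (ℓ F θ).κ ≤ κK F θ / 2 ∧ θK F θ ≤ (ℓ F θ).θ₅ ∧
        ((cA F θ * sC F θ * sB F θ + sA F θ * cC F θ * sB F θ + sA F θ * sC F θ * cB F θ) * VK F θ ^ 2) * θK F θ ≤ (ℓ F θ).C₅ * (ℓ F θ).θ₅)
    (hζm : ∀ (F : T4Family) (θ : Stage13HParams F 2), θ.Provisos₁₃CoPH F 2 → ((θ.ZhUnity F 2 ∧ θ.SlotsNondegenerate₁₃ F 2) ∧ θ.ppSel = ppSelLiveOfRecord F 2 θ.ν θ.τ9 (EOfRecord₁₃ F 2 θ.toStage13Params) (wOfRecord₉ F 2 θ.toStage9Params)) → θ.Admissible F 2 →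
      ZetaMeasurable F 2 θ.ζ)
    (h20 : ∀ (F : T4Family) (θ : Stage13HParams F 2) (hP : θ.Provisos₁₃CoPH F 2), ((θ.ZhUnity F 2 ∧ θ.SlotsNondegenerate₁₃ F 2) ∧ θ.ppSel = ppSelLiveOfRecord F 2 θ.ν θ.τ9 (EOfRecord₁₃ F 2 θ.toStage13Params) (wOfRecord₉ F 2 θ.toStage9Params)) → θ.Admissible F 2 →
      ∀ (g₀ : ℕ → ℝ) (os : List (ULoop F)),
        ∃ W : ℕ → ℝ, RelWeightBound 1 (classSet₁₃ θ K₀ g₀) (weightA₁₃ θ hP K₀ g₀ os) (weightB₁₃ θ hP K₀ g₀ os) (badClass₁₃ θ K₀ g₀ (jc F θ hP g₀ os)) W)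
    (h21 : ∀ (F : T4Family) (θ : Stage13HParams F 2) (hP : θ.Provisos₁₃CoPH F 2), ((θ.ZhUnity F 2 ∧ θ.SlotsNondegenerate₁₃ F 2) ∧ θ.ppSel = ppSelLiveOfRecord F 2 θ.ν θ.τ9 (EOfRecord₁₃ F 2 θ.toStage13Params) (wOfRecord₉ F 2 θ.toStage9Params)) → θ.Admissible F 2 →
      ∀ (g₀ : ℕ → ℝ) (os : List (ULoop F)),
        ∃ Wsh : ℕ → ℝ, ShellWeightBound 1 (classSet₁₃ θ K₀ g₀) (weightA₁₃ θ hP K₀ g₀ os) (weightB₁₃ θ hP K₀ g₀ os) (sh F θ hP g₀ os).1 (sh F θ hP g₀ os).2 Wsh)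
    (h19 : ∀ (F : T4Family) (θ : Stage13HParams F 2) (hP : θ.Provisos₁₃CoPH F 2), ((θ.ZhUnity F 2 ∧ θ.SlotsNondegenerate₁₃ F 2) ∧ θ.ppSel = ppSelLiveOfRecord F 2 θ.ν θ.τ9 (EOfRecord₁₃ F 2 θ.toStage13Params) (wOfRecord₉ F 2 θ.toStage9Params)) → θ.Admissible F 2 →
        ForSmallCouplings (datumOfRecord₁₃CoPH F 2 θ hP) fun g₀ => ∀ os : List (ULoop F),
          (RatesHolderAt (datumOfRecord₁₃CoPH F 2 θ hP)
            ⟨ne1OfRecord l₀ Λ F θ hP g₀ os, ne2OfRecord₁₁ (haveI := neZero_blockFactor F; fullGSizedObjects 3 F.hL b aS ν μ α β' c35 p),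
              ne3OfRecord₁₁ F { ne3ConstLayerOfRecord₁₁ F 2 (ℓ₃ F) with
                dom := {V | V ∈ ne3DomOfRecord₁₁ F 2 0 0 ∧ V ∈ sfClass 4 F.L (ne3NperOfRecord₁₁ F 0 0) ((ℓ₃ F).ε / B F) 0} },
              u3OfRecord₁₃ θ.toStage13Params (objectsOfRecord₁₃ F 2 θ.toStage13Params (ℓ F θ)) (ksel F θ hP g₀ os)⟩ β ∧
              ReadOutAt (datumOfRecord₁₃CoPH F 2 θ hP) (u3OfRecord₁₃ θ.toStage13Params (objectsOfRecord₁₃ F 2 θ.toStage13Params (ℓ F θ)) (ksel F θ hP g₀ os)) ∧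
              (0 ≤ (u3OfRecord₁₃ θ.toStage13Params (objectsOfRecord₁₃ F 2 θ.toStage13Params (ℓ F θ)) (ksel F θ hP g₀ os)).ρ ∧
                (u3OfRecord₁₃ θ.toStage13Params (objectsOfRecord₁₃ F 2 θ.toStage13Params (ℓ F θ)) (ksel F θ hP g₀ os)).ρ < 1)) →
            letI : DecidableEq (Σ K, SiteSeqKey F (K₀ + K)) := Classical.decEq _
            ∃ δ : ℕ → ℝ, NE7.Core 1 (F.side ^ 4) (classSet₁₃ θ K₀ g₀) (badClass₁₃ θ K₀ g₀ (jc F θ hP g₀ os))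
              (fun K t x => weightA₁₃ θ hP K₀ g₀ os K t x - (sh F θ hP g₀ os).1 K t x)
              (fun K t x => weightB₁₃ θ hP K₀ g₀ os K t x - (sh F θ hP g₀ os).2 K t x) δ ∧ Summable δ)
    (h20' : ∀ (F : T4Family) (θ : Stage13HParams F 2) (hP : θ.Provisos₁₃CoPH F 2), ((θ.ZhUnity F 2 ∧ θ.SlotsNondegenerate₁₃ F 2) ∧ ¬ θ.ppSel = ppSelLiveOfRecord F 2 θ.ν θ.τ9 (EOfRecord₁₃ F 2 θ.toStage13Params) (wOfRecord₉ F 2 θ.toStage9Params)) → θ.Admissible F 2 →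
      ∀ (g₀ : ℕ → ℝ) (os : List (ULoop F)),
        RelWeightBound (cr' F θ hP g₀ os).l₀ (cr' F θ hP g₀ os).T (cr' F θ hP g₀ os).A (cr' F θ hP g₀ os).B (cr' F θ hP g₀ os).Bad (cr' F θ hP g₀ os).W)
    (h21' : ∀ (F : T4Family) (θ : Stage13HParams F 2) (hP : θ.Provisos₁₃CoPH F 2), ((θ.ZhUnity F 2 ∧ θ.SlotsNondegenerate₁₃ F 2) ∧ ¬ θ.ppSel = ppSelLiveOfRecord F 2 θ.ν θ.τ9 (EOfRecord₁₃ F 2 θ.toStage13Params) (wOfRecord₉ F 2 θ.toStage9Params)) → θ.Admissible F 2 →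
      ∀ (g₀ : ℕ → ℝ) (os : List (ULoop F)),
        ShellWeightBound (cr' F θ hP g₀ os).l₀ (cr' F θ hP g₀ os).T (cr' F θ hP g₀ os).A (cr' F θ hP g₀ os).B (cr' F θ hP g₀ os).shA (cr' F θ hP g₀ os).shB
          (cr' F θ hP g₀ os).Wsh)
    (hx' : ∀ (F : T4Family) (θ : Stage13HParams F 2) (hP : θ.Provisos₁₃CoPH F 2), ((θ.ZhUnity F 2 ∧ θ.SlotsNondegenerate₁₃ F 2) ∧ ¬ θ.ppSel = ppSelLiveOfRecord F 2 θ.ν θ.τ9 (EOfRecord₁₃ F 2 θ.toStage13Params) (wOfRecord₉ F 2 θ.toStage9Params)) → θ.Admissible F 2 →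
        ForSmallCouplings (datumOfRecord₁₃CoPH F 2 θ hP) fun g₀ => ∀ os : List (ULoop F),
          0 < (cr' F θ hP g₀ os).l₀ ∧ 0 < (cr' F θ hP g₀ os).vol ∧
          (∀ (K : ℕ) (t : ℝ), |t| ≤ (cr' F θ hP g₀ os).l₀ →
            T4GenFunBounds.schemeZ ((datumOfRecord₁₃CoPH F 2 θ hP).scheme g₀) os ((cr' F θ hP g₀ os).K₀ + K) t =
              ∑ τ ∈ (cr' F θ hP g₀ os).T K, (cr' F θ hP g₀ os).A K t τ) ∧
          (∀ (K : ℕ) (t : ℝ), |t| ≤ (cr' F θ hP g₀ os).l₀ →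
            T4GenFunBounds.schemeZ ((datumOfRecord₁₃CoPH F 2 θ hP).scheme g₀) os ((cr' F θ hP g₀ os).K₀ + K + 1) t =
              ∑ τ ∈ (cr' F θ hP g₀ os).T K, (cr' F θ hP g₀ os).B K t τ))
    (h19' : ∀ (F : T4Family) (θ : Stage13HParams F 2) (hP : θ.Provisos₁₃CoPH F 2), ((θ.ZhUnity F 2 ∧ θ.SlotsNondegenerate₁₃ F 2) ∧ ¬ θ.ppSel = ppSelLiveOfRecord F 2 θ.ν θ.τ9 (EOfRecord₁₃ F 2 θ.toStage13Params) (wOfRecord₉ F 2 θ.toStage9Params)) → θ.Admissible F 2 →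
        ForSmallCouplings (datumOfRecord₁₃CoPH F 2 θ hP) fun g₀ => ∀ os : List (ULoop F),
          (RatesHolderAt (datumOfRecord₁₃CoPH F 2 θ hP)
            ⟨ne1OfRecord l₀ Λ F θ hP g₀ os, ne2OfRecord₁₁ (haveI := neZero_blockFactor F; fullGSizedObjects 3 F.hL b aS ν μ α β' c35 p),
              ne3OfRecord₁₁ F { ne3ConstLayerOfRecord₁₁ F 2 (ℓ₃ F) with
                dom := {V | V ∈ ne3DomOfRecord₁₁ F 2 0 0 ∧ V ∈ sfClass 4 F.L (ne3NperOfRecord₁₁ F 0 0) ((ℓ₃ F).ε / B F) 0} },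
              u3OfRecord₁₃ θ.toStage13Params (objectsOfRecord₁₃ F 2 θ.toStage13Params (ℓ F θ)) (ksel F θ hP g₀ os)⟩ β ∧
              ReadOutAt (datumOfRecord₁₃CoPH F 2 θ hP) (u3OfRecord₁₃ θ.toStage13Params (objectsOfRecord₁₃ F 2 θ.toStage13Params (ℓ F θ)) (ksel F θ hP g₀ os)) ∧
              (0 ≤ (u3OfRecord₁₃ θ.toStage13Params (objectsOfRecord₁₃ F 2 θ.toStage13Params (ℓ F θ)) (ksel F θ hP g₀ os)).ρ ∧
                (u3OfRecord₁₃ θ.toStage13Params (objectsOfRecord₁₃ F 2 θ.toStage13Params (ℓ F θ)) (ksel F θ hP g₀ os)).ρ < 1)) →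
            letI := (cr' F θ hP g₀ os).dec
            ∃ δ : ℕ → ℝ, NE7.Core (cr' F θ hP g₀ os).l₀ (cr' F θ hP g₀ os).vol (cr' F θ hP g₀ os).T (cr' F θ hP g₀ os).Bad
              (fun K t τ => (cr' F θ hP g₀ os).A K t τ - (cr' F θ hP g₀ os).shA K t τ) (fun K t τ => (cr' F θ hP g₀ os).B K t τ - (cr' F θ hP g₀ os).shB K t τ) δ ∧
              Summable δ) :
    SpineGivenEndpointR13SepCoPHV := by
  let lit : (F : T4Family) → (θ : Stage13HParams F 2) → θ.Provisos₁₃CoPH F 2 → (ℕ → ℝ) → List (ULoop F) → Literature.MathematicalPhysics.QuantumFieldTheory.Balaban1983to89.Node00.RateObjects₁₁ 2 :=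
    fun F θ _ _ _ =>
      ⟨objectsOfRecord₁₃ F 2 θ.toStage13Params (ℓ F θ),
        fun _ => { ne3ConstLayerOfRecord₁₁ F 2 (ℓ₃ F) with
          dom := {V | V ∈ ne3DomOfRecord₁₁ F 2 0 0 ∧ V ∈ sfClass 4 F.L (ne3NperOfRecord₁₁ F 0 0) ((ℓ₃ F).ε / B F) 0} },
        fun _ => haveI := neZero_blockFactor F; fullGSizedObjects 3 F.hL b aS ν μ α β' c35 p⟩
  let 𝔯 : YMDAG.UVSplit.RateReading₁₃CoPH 2 := ⟨lit, YMDAG.N14.TopBorn.ne1OfRecord l₀ Λ⟩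
  have hpin1 : YMDAG.N14.TopBorn.Ne1PinnedOfRecord 𝔯 := ⟨l₀, Λ, hl₀, hΛ, fun _ _ _ _ _ => rfl⟩
  have hpin2 : ∃ (b aS : ℝ) (ν μ α β' : Fin 4) (c35 p : ℝ), 0 < b ∧ 0 < aS ∧
      ∀ (F : T4Family) (θ : Stage13HParams F 2) (hP : θ.Provisos₁₃CoPH F 2) (g₀ : ℕ → ℝ) (os : List (ULoop F)) (k : ℕ),
        (𝔯.lit F θ hP g₀ os).ne2 k = haveI := neZero_blockFactor F; fullGSizedObjects 3 F.hL b aS ν μ α β' c35 p :=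
    ⟨b, aS, ν, μ, α, β', c35, p, hb, haS, fun _ _ _ _ _ _ => rfl⟩
  have hpinL : Summit.QuantumFields.YangMills.BalabanUVNodes.N16PinnedLayer13CoPH.N16PinnedLoose 𝔯 ℓ₃ B := fun _ _ _ _ _ _ => rfl
  have hpin : ∀ (F : T4Family) (θ : Stage13HParams F 2) (hP : θ.Provisos₁₃CoPH F 2) (g₀ : ℕ → ℝ) (os : List (ULoop F)),
      (𝔯.lit F θ hP g₀ os).u3 = objectsOfRecord₁₃ F 2 θ.toStage13Params (ℓ F θ) := fun _ _ _ _ _ => rfl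
  obtain ⟨hS, hW⟩ := windowedRowsOfRecord₁₃_guarded_of_kingMechanism ℓ s ρd q p₁ p₂ uA vA CA uB vB CB κK θK VK sA sC sB cA cC cB
    (fun F (θ : Stage13HParams F 2) => (θ.ZhUnity F 2 ∧ θ.SlotsNondegenerate₁₃ F 2)) hs hks hρ0 hρtri hd hV hA hB hu hCA hvA hCB hvB hdu hdC hdv hdom
  have hU := fun (F : T4Family) (θ : Stage13HParams F 2) (hP : θ.Provisos₁₃CoPH F 2) (hG : (θ.ZhUnity F 2 ∧ θ.SlotsNondegenerate₁₃ F 2)) (hθ : θ.Admissible F 2) =>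
    u3KernelInputs_of_finiteVolumeLetters F 2 θ.toStage13Params (ℓ F θ) (hs F θ hP hG hθ) (s F θ) (hr F θ hP hG hθ) (hinc F θ hP hG hθ) (hS F θ hP hG hθ)
      (h9 F θ hP hG hθ) (hW F θ hP hG hθ)
  exact fun F θ h v hG hθ _ _ =>
    hybridNE7Under_of_forSmallCouplings_stringwise (Node00.datumOfRecord₁₃SepCoPHV F 2 θ h v)
      (show ForSmallCouplings (Node00.datumOfRecord₁₃SepCoPHV F 2 θ h v) (fun g₀ => StringwiseHybridNE7 ((Node00.datumOfRecord₁₃SepCoPHV F 2 θ h v).scheme g₀)) from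
        bodyBFree₁₃CoPH_of_split (fun F (θ : Stage13HParams F 2) => (θ.ZhUnity F 2 ∧ θ.SlotsNondegenerate₁₃ F 2))
          (fun F (θ : Stage13HParams F 2) => θ.ppSel = ppSelLiveOfRecord F 2 θ.ν θ.τ9 (EOfRecord₁₃ F 2 θ.toStage13Params) (wOfRecord₉ F 2 θ.toStage9Params))
          (bodyBFree₁₃CoPH_of_v5pins_at_crOfRecord₁₃VAt_cut_of_finiteVolumeLetters K₀ jc sh β 𝔯 ksel ℓ s r ℓ₃ B
          (fun F (θ : Stage13HParams F 2) => (θ.ZhUnity F 2 ∧ θ.SlotsNondegenerate₁₃ F 2) ∧ θ.ppSel = ppSelLiveOfRecord F 2 θ.ν θ.τ9 (EOfRecord₁₃ F 2 θ.toStage13Params) (wOfRecord₉ F 2 θ.toStage9Params)) hpin1 hpin2 hpinL hpin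
          (fun F hF => h16 F (hF.elim fun θ h => ⟨θ, h.1, h.2.1.1, h.2.2⟩))
          (fun F θ hP hRg hθ => hs F θ hP hRg.1 hθ) (fun F θ hP hRg hθ => hκ F θ hP hRg.1 hθ) (fun F θ hP hRg hθ => hcr F θ hP hRg.1 hθ)
          (fun F θ hP hRg hθ => hρ F θ hP hRg.1 hθ) (fun F θ hP hRg hθ => hr F θ hP hRg.1 hθ) (fun F θ hP hRg hθ => hinc F θ hP hRg.1 hθ)
          (fun F θ hP hRg hθ => hS F θ hP hRg.1 hθ) (fun F θ hP hRg hθ => h9 F θ hP hRg.1 hθ) (fun F θ hP hRg hθ => hW F θ hP hRg.1 hθ) (fun _ _ _ hRg _ => ⟨_, hRg.2⟩) hζm h20 h21 h19)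
          (bodyBFree₁₃CoPH_of_kernels_pin_bFree cr' 𝔯 ksel (fun {F} (θ : Stage13HParams F 2) => ((θ.ZhUnity F 2 ∧ θ.SlotsNondegenerate₁₃ F 2) ∧ ¬ θ.ppSel = ppSelLiveOfRecord F 2 θ.ν θ.τ9 (EOfRecord₁₃ F 2 θ.toStage13Params) (wOfRecord₉ F 2 θ.toStage9Params))) ℓ β hpin
            (fun F θ hP hRg hθ => ForSmallCouplings.of_forall fun g₀ os => by
              refine ⟨?_, ?_, ?_⟩
              · exact n14At_rateCarriersOfRecord₁₃CoPH_of_pinned 𝔯 hpin1 F θ hP g₀ os (ksel F θ hP g₀ os)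
              · obtain ⟨b, aS, ν, μ, α, β', c35, p, hb, haS, h⟩ := hpin2
                rw [h F θ hP g₀ os]
                exact n15At_fullGSizedObjects_family hb haS ν μ α β' c35 p F
              · show N16HolderAt (rateCarriersOfRecord₁₃CoPH 𝔯 F θ hP g₀ os (ksel F θ hP g₀ os)).ne3 β
                rw [rateCarriers_ne3_of_pinnedLoose hpinL F θ hP g₀ os (ksel F θ hP g₀ os)]
                exact h16 F ⟨θ, hP, hRg.1, hθ⟩)
            (fun F θ hP hRg hθ => hs F θ hP hRg.1 hθ) (fun F θ hP hRg hθ => hκ F θ hP hRg.1 hθ) (fun F θ hP hRg hθ => hcr F θ hP hRg.1 hθ)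
            (fun F θ hP hRg hθ => hρ F θ hP hRg.1 hθ) h20' h21' h19' hx'
            (fun F θ hP hRg hθ => (hU F θ hP hRg.1 hθ).1) (fun F θ hP hRg hθ => (hU F θ hP hRg.1 hθ).2.1)
            (fun F θ hP hRg hθ => (hU F θ hP hRg.1 hθ).2.2))
          F θ h.toCore hG hθ) _

end King

end Summit.QuantumFields.YangMills.Theorems.BalabanUVNodesN27SpineRecord
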